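import Literature.NumberTheory.Sieve.FriedlanderIwaniecSpinCharSumsProp172
import Literature.NumberTheory.Sieve.FriedlanderIwaniecPrimesLinearForms
import HarnessLib

/-!
# Friedlander–Iwaniec, *The polynomial `X² + Y⁴` captures its primes*: Proposition 17.2 in the `z`-form (17.12)/(17.14)

Family `parity` (Line A of the FI `a² + b⁴` completion, node (vi)). Source: J. Friedlander,
H. Iwaniec, Ann. of Math. (2) 148 (1998), 945–1040 [FriedlanderIwaniecAnnals1998] (= arXiv:math/9811185),
§17 (17.12)–(17.18) and §25 (25.1) (arXiv pp. 67–68, 83). In §17 the character sum is a sum over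
Gaussian integers, (17.12) `S^k_χ(β') = Σ_z β'_z χ(z)(z/|z|)^k`, (17.14)
`S^k_χ(β') = Σ^∧_{(z,Π)=1} β_z [z] χ(z)(z/|z|)^k` ("`Σ^∧` restricts to primary numbers"), with
(17.15) `β_z = p(n)μ(n)Σ_{c∣n, c≤C} μ(c)`, `n = z z̄`, and (17.16) `[z] = i^{(r-1)/2}(s/|r|)`; in §25
it is re-read as a sum over `n` ((25.1) `S^k_χ(β') = Σ_{(m,Π)=1} g(m)μ(m)γ(m)λ(m)`) through the
quadratic eigenvalue (23.1) `λ(n) = Σ_{z z̄ = n, z primary} ψ(z)[z]`. Proposition 17.2 was proved in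
the tree in the `n`-form (`FriedlanderIwaniec1998_prop172`, `norm_spinCharSum_le`); this file records
the fibring identity and the `z`-form, which is the shape consumed by (17.13).

## Contents (everything PROVED; no definitions, no named facts)

* `sum_primaryNormLE_mul_heckePsi_mul_jacobiKubota` — (17.14) = (25.1):
  `Σ_{z primary, 1 ≤ z z̄ ≤ X} w(z z̄) ψ(z)[z] = Σ_{n ≤ X} w(n) λ(n)` [tree: `primaryNormLE`,
  `heckePsi`, `jacobiKubota`, `quadEigenvalue`];
* `FriedlanderIwaniec1998_prop172_zForm` — **Proposition 17.2 for (17.14)**: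
  `‖Σ^∧_z β_z [z] χ(z)(z/|z|)^k‖ ≤ K N^{1-δ}` uniformly in `d(|k|+1) ≤ N^δ`, `β_z = fiBeta₀ p C P (z z̄)`
  (the weight `p` of (4.13), `C ≤ N^{1-η}`).

## References

* J. Friedlander, H. Iwaniec, Ann. of Math. (2) 148 (1998), 945–1040, §17 (17.12)–(17.18),
  Proposition 17.2; §23 (23.1); §25 (25.1). [FriedlanderIwaniecAnnals1998]

## Tree / Mathlib

Tree: `FriedlanderIwaniec1998_prop172` (`FriedlanderIwaniecSpinCharSumsProp172`), `fiBeta₀`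
(`FriedlanderIwaniecSpinCharSums`), `quadEigenvalue`, `heckePsi` (`FriedlanderIwaniecSpin`),
`jacobiKubota` (`…JacobiKubota`), `primaryNormLE` (`…LinearForms`), `primaryNormEq`,
`mem_primaryNormEq` (`QuadraticFields/GaussianPrimary`). Mathlib: `Finset.sum_biUnion`.
-/

noncomputable section

open Finset

namespace Literature.NumberTheory.Sieve.FriedlanderIwaniecPrimes

open Literature.NumberTheory.QuadraticFields.GaussianPrimary

/-- **(17.14) = (25.1).** A sum over the primary `z ∈ ℤ[i]` with `1 ≤ z z̄ ≤ X` of `w(z z̄) ψ(z) [z]`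
fibres over the norm: it equals `Σ_{1 ≤ n ≤ X} w(n) λ(n)`, `λ` the quadratic eigenvalue (23.1).
[cite: FriedlanderIwaniecAnnals1998, (17.14), (23.1), (25.1)] -/
theorem sum_primaryNormLE_mul_heckePsi_mul_jacobiKubota (w : ℕ → ℂ) (d : ℕ)
    (χ : MulChar (GaussQuot (4 * d)) ℂ) (k : ℤ) (X : ℕ) :
    ∑ z ∈ primaryNormLE X, w z.norm.natAbs * (heckePsi d χ k z * jacobiKubota z) =
      ∑ n ∈ Icc 1 X, w n * quadEigenvalue d χ k n := by
  rw [primaryNormLE, sum_biUnion]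
  · refine sum_congr rfl fun n _ => ?_
    rw [quadEigenvalue, mul_sum]
    refine sum_congr rfl fun z hz => ?_
    have hn : z.norm.natAbs = n := by
      rw [(mem_primaryNormEq.mp hz).1, Int.natAbs_natCast]
    rw [hn]
  · intro n₁ _ n₂ _ hne
    simp only [Function.onFun]
    rw [Finset.disjoint_left]
    intro z h₁ h₂
    have e₁ := (mem_primaryNormEq.mp h₁).1
    have e₂ := (mem_primaryNormEq.mp h₂).1
    exact hne (by exact_mod_cast e₁.symm.trans e₂)

/-- **Friedlander–Iwaniec, Proposition 17.2, `z`-form (17.14).** For every `η > 0` there are `δ > 0`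
and `K` such that for `N ≥ 1`, `N < N' < 2N`, `0 < θ ≤ 1 ≤ θN`, every differentiable weight `p`
supported in `(N', (1+θ)N']` with `|p| ≤ 1`, `|p'| ≤ (θN)⁻¹`, all `C ≤ N^{1-η}`, `P`, and every
character `ψ(z) = χ(z)(z/|z|)^k`, `χ (mod 4d)`, with `d(|k|+1) ≤ N^δ`:
`‖Σ_{z primary} β_z [z] ψ(z)‖ ≤ K N^{1-δ}`, `β_z = p(z z̄) μ(z z̄) γ(z z̄, C) ρ_P(z z̄)` ((17.14)–(17.15),
`fiBeta₀`), `[z]` the Jacobi–Kubota symbol (17.16). From the `n`-form `FriedlanderIwaniec1998_prop172`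
by `sum_primaryNormLE_mul_heckePsi_mul_jacobiKubota`.
[cite: FriedlanderIwaniecAnnals1998, Proposition 17.2] -/
theorem FriedlanderIwaniec1998_prop172_zForm {η : ℝ} (hη : 0 < η) :
    ∃ δ : ℝ, 0 < δ ∧ ∃ K : ℝ, 0 < K ∧ ∀ N : ℕ, 1 ≤ N → ∀ N' θ : ℝ, (N : ℝ) < N' → N' < 2 * N →
      0 < θ → θ ≤ 1 → 1 ≤ θ * N →
      ∀ p : ℝ → ℝ, Differentiable ℝ p → (∀ u, p u ≠ 0 → N' < u ∧ u ≤ (1 + θ) * N') →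
      (∀ u, |p u| ≤ 1) → (∀ u, |deriv p u| ≤ (θ * N)⁻¹) →
      ∀ C P : ℝ, C ≤ (N : ℝ) ^ (1 - η) →
      ∀ d : ℕ, 1 ≤ d → ∀ χ : MulChar (GaussQuot (4 * d)) ℂ, ∀ k : ℤ,
        (d * (|k| + 1) : ℝ) ≤ (N : ℝ) ^ δ →
        ‖∑ z ∈ primaryNormLE ⌊(1 + θ) * N'⌋₊,
            ((fiBeta₀ p C P z.norm.natAbs : ℝ) : ℂ) * (heckePsi d χ k z * jacobiKubota z)‖ ≤
          K * (N : ℝ) ^ (1 - δ) := by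
  obtain ⟨δ, hδ, K, hK, h⟩ := FriedlanderIwaniec1998_prop172 hη
  refine ⟨δ, hδ, K, hK, ?_⟩
  intro N hN N' θ hNN' hN'2 hθ0 hθ1 hθN p hpd hpsupp hp1 hp' C P hC d hd χ k hdk
  rw [sum_primaryNormLE_mul_heckePsi_mul_jacobiKubota (fun n => ((fiBeta₀ p C P n : ℝ) : ℂ))]
  exact h N hN N' θ hNN' hN'2 hθ0 hθ1 hθN p hpd hpsupp hp1 hp' C P hC d hd χ k hdk

end Literature.NumberTheory.Sieve.FriedlanderIwaniecPrimes
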